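import Mathlib.Analysis.Calculus.ContDiff.Convolution
import Mathlib.Analysis.Calculus.BumpFunction.Convolution
import Mathlib.Analysis.Calculus.BumpFunction.InnerProduct
import Mathlib.Analysis.Complex.Conformal
import Literature.Probability.Percolation.SmirnovContinuumLimitProofs
import Literature.Probability.Percolation.SmirnovConformalProofs

/-!
# Stub `stub_contourFromCells` of the line `continuum-smirnov-dipole`
(crux `CardyRotToConfR2SymmetryUpgrade`, stmt-CriticalPhenomena-0698)

The pure-analysis passage from Smirnov's mesoscopic `2π/3`-dipole identity to the contour
relation (36) of Bollobás–Riordan (*Percolation*, CUP 2006, Ch. 7, p. 199): if two real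
functions `Gⁱ, G^{i+1}` are continuous on an open set `U ⊆ ℂ` and the dipole quotient
`(Gⁱ(z+εη) − Gⁱ(z) − (G^{i+1}(z+εωη) − G^{i+1}(z)))/ε` tends to `0` as `ε → 0⁺`, uniformly on
compact subsets of `U`, for every unit vector `η` and a fixed unit `ω`, then
`∮_{∂T} (G^{i+1} − ω Gⁱ) dz = 0` for every solid triangle `T ⊆ U`.

Proof (standard): mollify the pair (convolution with a normed smooth bump of radius `δ`);
the mollified pair satisfies the *exact* dipole identity `D g₁[η] = D g₂[ωη]` near `T`, and for
`|ω| = 1` this makes the differential of `g₂ − ω g₁` complex-linear (Cauchy–Riemann), so the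
mollified combination is holomorphic near `T` and its triangle integral vanishes
(Cauchy–Goursat, `triangleIntegral_eq_zero_of_differentiableOn`); finally let `δ → 0` using the
uniform convergence of the mollifications on `T`.
-/

noncomputable section

open MeasureTheory Set Filter Topology Metric ContinuousLinearMap
open scoped Convolution
open Literature.Probability.Percolation (segmentIntegral triangleIntegral segmentIntegral_eq
  triangleIntegral_linear triangleIntegral_eq_zero_of_differentiableOn)

namespace Summit.CriticalPhenomena.CardyFormulaZ2.Theorems.CardyRotToConfR2SymmetryUpgrade.ContinuumSmirnovDipole

/-! ### Cauchy–Riemann from the exact dipole identity -/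

/-- **Key algebra.** If `g₁, g₂ : ℂ → ℝ` have real differentials `ℓ₁, ℓ₂` at `z` with
`ℓ₁ 1 = ℓ₂ ω` and `ℓ₁ I = ℓ₂ (ω I)` (the exact dipole identity on a real basis) and `|ω| = 1`,
then `w ↦ g₂ w − ω g₁ w` is complex-differentiable at `z` (its differential is complex-linear).
[folklore] -/
theorem differentiableAt_sub_mul_of_dipole {g₁ g₂ : ℂ → ℝ} {ℓ₁ ℓ₂ : ℂ →L[ℝ] ℝ} {z ω : ℂ}
    (hω : ‖ω‖ = 1) (h₁ : HasFDerivAt g₁ ℓ₁ z) (h₂ : HasFDerivAt g₂ ℓ₂ z)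
    (e₁ : ℓ₁ 1 = ℓ₂ ω) (e₂ : ℓ₁ Complex.I = ℓ₂ (ω * Complex.I)) :
    DifferentiableAt ℂ (fun w => (g₂ w : ℂ) - ω * g₁ w) z := by
  have hf : HasFDerivAt (fun w => (g₂ w : ℂ) - ω * g₁ w)
      (Complex.ofRealCLM.comp ℓ₂ - ω • Complex.ofRealCLM.comp ℓ₁) z :=
    (Complex.ofRealCLM.hasFDerivAt.comp z h₂).sub
      ((Complex.ofRealCLM.hasFDerivAt.comp z h₁).const_mul ω)
  refine differentiableAt_complex_iff_differentiableAt_real.2 ⟨hf.differentiableAt, ?_⟩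
  rw [hf.fderiv]
  simp only [_root_.sub_apply, _root_.smul_apply, ContinuousLinearMap.comp_apply,
    Complex.ofRealCLM_apply, smul_eq_mul, e₁, e₂]
  have hω' : ω = ω.re • (1 : ℂ) + ω.im • Complex.I := by
    rw [Complex.real_smul, Complex.real_smul, mul_one, Complex.re_add_im]
  have hωI : ω * Complex.I = (-ω.im) • (1 : ℂ) + ω.re • Complex.I := by
    rw [Complex.real_smul, Complex.real_smul, mul_one]
    apply Complex.ext <;> simp
  have k₁ : ℓ₂ ω = ω.re * ℓ₂ 1 + ω.im * ℓ₂ Complex.I := by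
    conv_lhs => rw [hω']
    rw [map_add, map_smul, map_smul, smul_eq_mul, smul_eq_mul]
  have k₂ : ℓ₂ (ω * Complex.I) = -ω.im * ℓ₂ 1 + ω.re * ℓ₂ Complex.I := by
    rw [hωI, map_add, map_smul, map_smul, smul_eq_mul, smul_eq_mul]
  have hn : ω.re * ω.re + ω.im * ω.im = 1 := by
    have h := Complex.sq_norm ω
    rw [hω, Complex.normSq_apply] at h
    linarith
  rw [k₁, k₂]
  apply Complex.ext
  · simp
    linear_combination (-ℓ₂ Complex.I) * hn
  · simp
    linear_combination (ℓ₂ 1) * hn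

/-- One-sided directional difference quotients of a real-differentiable function converge to the
directional derivative. [folklore] -/
theorem tendsto_slope_of_hasFDerivAt {g : ℂ → ℝ} {ℓ : ℂ →L[ℝ] ℝ} {z : ℂ}
    (h : HasFDerivAt g ℓ z) (v : ℂ) :
    Tendsto (fun ε : ℝ => (g (z + (ε : ℂ) * v) - g z) / ε) (𝓝[>] (0 : ℝ)) (𝓝 (ℓ v)) := by
  have hline : HasDerivAt (fun t : ℝ => z + (t : ℂ) * v) v 0 := by
    have hid : HasDerivAt (fun t : ℝ => (t : ℂ)) 1 (0 : ℝ) := by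
      simpa using (hasDerivAt_id (0 : ℝ)).ofReal_comp
    simpa using (hid.mul_const v).const_add z
  have hcomp : HasDerivAt (g ∘ fun t : ℝ => z + (t : ℂ) * v) (ℓ v) 0 :=
    h.comp_hasDerivAt_of_eq (0 : ℝ) hline (by simp)
  rw [hasDerivAt_iff_tendsto_slope_zero] at hcomp
  refine (hcomp.mono_left (nhdsGT_le_nhdsNE 0)).congr fun t => ?_
  simp only [Function.comp_apply, zero_add, Complex.ofReal_zero, zero_mul, add_zero, smul_eq_mul]
  ring

/-! ### Contour integrals: a norm bound and linearity -/

/-- `‖∫_{[p,q]} f dz‖ ≤ C ‖q − p‖` if `‖f‖ ≤ C` on the segment. [folklore] -/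
theorem norm_segmentIntegral_le {f : ℂ → ℂ} {p q : ℂ} {C : ℝ}
    (h : ∀ z ∈ segment ℝ p q, ‖f z‖ ≤ C) : ‖segmentIntegral f p q‖ ≤ C * ‖q - p‖ := by
  rw [segmentIntegral_eq]
  have hb := intervalIntegral.norm_integral_le_of_norm_le_const (a := (0 : ℝ)) (b := 1)
    (C := C * ‖q - p‖) (f := fun t => f (AffineMap.lineMap p q t) * (q - p)) ?_
  · simpa using hb
  · intro t ht
    rw [uIoc_of_le zero_le_one] at ht
    rw [norm_mul]
    refine mul_le_mul_of_nonneg_right (h _ ?_) (norm_nonneg _)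
    rw [segment_eq_image_lineMap]
    exact ⟨t, ⟨ht.1.le, ht.2⟩, rfl⟩

/-- `‖∮_{∂(pqr)} f dz‖ ≤ C · perimeter` if `‖f‖ ≤ C` on the solid triangle. [folklore] -/
theorem norm_triangleIntegral_le {f : ℂ → ℂ} {p q r : ℂ} {C : ℝ}
    (h : ∀ z ∈ convexHull ℝ {p, q, r}, ‖f z‖ ≤ C) :
    ‖triangleIntegral f p q r‖ ≤ C * (‖q - p‖ + ‖r - q‖ + ‖p - r‖) := by
  have hp : p ∈ ({p, q, r} : Set ℂ) := by simp
  have hq : q ∈ ({p, q, r} : Set ℂ) := by simp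
  have hr : r ∈ ({p, q, r} : Set ℂ) := by simp
  have spq := segment_subset_convexHull (𝕜 := ℝ) hp hq
  have sqr := segment_subset_convexHull (𝕜 := ℝ) hq hr
  have srp := segment_subset_convexHull (𝕜 := ℝ) hr hp
  unfold triangleIntegral
  calc ‖segmentIntegral f p q + segmentIntegral f q r + segmentIntegral f r p‖
      ≤ ‖segmentIntegral f p q‖ + ‖segmentIntegral f q r‖ + ‖segmentIntegral f r p‖ :=
        norm_add₃_le
    _ ≤ C * ‖q - p‖ + C * ‖r - q‖ + C * ‖p - r‖ :=
        add_le_add_three (norm_segmentIntegral_le fun z hz => h z (spq hz))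
          (norm_segmentIntegral_le fun z hz => h z (sqr hz))
          (norm_segmentIntegral_le fun z hz => h z (srp hz))
    _ = C * (‖q - p‖ + ‖r - q‖ + ‖p - r‖) := by ring

/-- `∮ (f − g) = ∮ f − ∮ g` for integrands continuous on the solid triangle. [folklore] -/
theorem triangleIntegral_sub {f g : ℂ → ℂ} {p q r : ℂ}
    (hf : ContinuousOn f (convexHull ℝ {p, q, r})) (hg : ContinuousOn g (convexHull ℝ {p, q, r})) :
    triangleIntegral (fun w => f w - g w) p q r =
      triangleIntegral f p q r - triangleIntegral g p q r := by
  have h := triangleIntegral_linear hf hg (continuousOn_const (c := (0 : ℂ))) 1 (-1) 0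
  have he : (fun w => 1 * f w + -1 * g w + 0 * (0 : ℂ)) = fun w => f w - g w := by
    funext w; ring
  rw [he] at h
  rw [h]
  ring

/-! ### Mollification by a normed bump -/

/-- Mollifications (convolution with a normed smooth bump `φ`) of locally integrable functions
are `C¹`. [folklore] -/
theorem contDiff_normed_convolution (φ : ContDiffBump (0 : ℂ)) {g : ℂ → ℝ}
    (hg : LocallyIntegrable g volume) : ContDiff ℝ 1 (φ.normed volume ⋆[lsmul ℝ ℝ, volume] g) :=
  φ.hasCompactSupport_normed.contDiff_convolution_left _ φ.contDiff_normed hg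

/-- The convolution integrand of a mollification is integrable. [folklore] -/
theorem integrable_normed_mul (φ : ContDiffBump (0 : ℂ)) {g : ℂ → ℝ}
    (hg : LocallyIntegrable g volume) (x : ℂ) :
    Integrable (fun t => φ.normed volume t * g (x - t)) volume :=
  φ.hasCompactSupport_normed.convolutionExists_left (lsmul ℝ ℝ) φ.continuous_normed hg x

/-! ### The mollified combination is holomorphic -/

/-- **Exact dipole identity after mollification ⇒ holomorphy.** If `g₁, g₂` are locally
integrable, the `rOut`-ball around `z` is mapped into `K` by `t ↦ z − t`, and the dipole quotient
of `(g₁, g₂)` tends to `0` uniformly on `K` as `ε → 0⁺` for every unit direction, then the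
mollified combination `φ ⋆ g₂ − ω · φ ⋆ g₁` is complex-differentiable at `z`. [folklore] -/
theorem differentiableAt_normed_convolution_comb {g₁ g₂ : ℂ → ℝ} {ω z : ℂ} {K : Set ℂ}
    (φ : ContDiffBump (0 : ℂ)) (hω : ‖ω‖ = 1)
    (hg₁ : LocallyIntegrable g₁ volume) (hg₂ : LocallyIntegrable g₂ volume)
    (hK : ∀ t : ℂ, ‖t‖ < φ.rOut → z - t ∈ K)
    (hdip : ∀ η : ℂ, ‖η‖ = 1 → TendstoUniformlyOn
      (fun (ε : ℝ) (y : ℂ) =>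
        (g₁ (y + (ε : ℂ) * η) - g₁ y - (g₂ (y + (ε : ℂ) * (ω * η)) - g₂ y)) / ε)
      (fun _ => (0 : ℝ)) (𝓝[>] (0 : ℝ)) K) :
    DifferentiableAt ℂ (fun w => ((φ.normed volume ⋆[lsmul ℝ ℝ, volume] g₂) w : ℂ) -
      ω * (φ.normed volume ⋆[lsmul ℝ ℝ, volume] g₁) w) z := by
  set ψ : ℂ → ℝ := φ.normed volume with hψ
  set M₁ : ℂ → ℝ := ψ ⋆[lsmul ℝ ℝ, volume] g₁
  set M₂ : ℂ → ℝ := ψ ⋆[lsmul ℝ ℝ, volume] g₂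
  have hM₁a : ∀ x, M₁ x = ∫ t, ψ t * g₁ (x - t) := fun x => rfl
  have hM₂a : ∀ x, M₂ x = ∫ t, ψ t * g₂ (x - t) := fun x => rfl
  have hd₁ : HasFDerivAt M₁ (fderiv ℝ M₁ z) z :=
    (((contDiff_normed_convolution φ hg₁).differentiable one_ne_zero) z).hasFDerivAt
  have hd₂ : HasFDerivAt M₂ (fderiv ℝ M₂ z) z :=
    (((contDiff_normed_convolution φ hg₂).differentiable one_ne_zero) z).hasFDerivAt
  set ℓ₁ := fderiv ℝ M₁ z
  set ℓ₂ := fderiv ℝ M₂ z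
  -- the exact dipole identity for the mollified pair
  have key : ∀ η : ℂ, ‖η‖ = 1 → ℓ₁ η = ℓ₂ (ω * η) := by
    intro η hη
    set DQ : ℝ → ℝ := fun ε =>
      (M₁ (z + (ε : ℂ) * η) - M₁ z) / ε - (M₂ (z + (ε : ℂ) * (ω * η)) - M₂ z) / ε with hDQ
    have lim₁ : Tendsto DQ (𝓝[>] (0 : ℝ)) (𝓝 (ℓ₁ η - ℓ₂ (ω * η))) :=
      (tendsto_slope_of_hasFDerivAt hd₁ η).sub (tendsto_slope_of_hasFDerivAt hd₂ (ω * η))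
    have lim₂ : Tendsto DQ (𝓝[>] (0 : ℝ)) (𝓝 0) := by
      rw [Metric.tendsto_nhds]
      intro e he
      have hev := (Metric.tendstoUniformlyOn_iff.1 (hdip η hη)) (e / 2) (half_pos he)
      filter_upwards [hev, self_mem_nhdsWithin] with ε hε hε₀
      rw [mem_Ioi] at hε₀
      -- the dipole quotient of the mollifications is the mollified dipole quotient
      have i₁ := integrable_normed_mul φ hg₁ (z + (ε : ℂ) * η)
      have i₂ := integrable_normed_mul φ hg₁ z
      have i₃ := integrable_normed_mul φ hg₂ (z + (ε : ℂ) * (ω * η))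
      have i₄ := integrable_normed_mul φ hg₂ z
      have i₅ : Integrable (fun t => (ψ t * g₁ (z + (ε : ℂ) * η - t) - ψ t * g₁ (z - t)) / ε)
          volume := by exact (i₁.sub i₂).div_const ε
      have i₆ : Integrable (fun t =>
          (ψ t * g₂ (z + (ε : ℂ) * (ω * η) - t) - ψ t * g₂ (z - t)) / ε) volume := by
        exact (i₃.sub i₄).div_const ε
      have hrepr : DQ ε = ∫ t, ψ t *
          ((g₁ (z - t + (ε : ℂ) * η) - g₁ (z - t) -
            (g₂ (z - t + (ε : ℂ) * (ω * η)) - g₂ (z - t))) / ε) := by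
        simp only [hDQ, hM₁a, hM₂a]
        rw [← integral_sub i₁ i₂, ← integral_sub i₃ i₄, ← integral_div, ← integral_div,
          ← integral_sub i₅ i₆]
        refine integral_congr_ae (ae_of_all _ fun t => ?_)
        beta_reduce
        rw [add_sub_right_comm z _ t, add_sub_right_comm z _ t]
        ring
      rw [dist_zero_right, Real.norm_eq_abs, hrepr]
      have hbound : ∀ t : ℂ, ‖ψ t *
          ((g₁ (z - t + (ε : ℂ) * η) - g₁ (z - t) -
            (g₂ (z - t + (ε : ℂ) * (ω * η)) - g₂ (z - t))) / ε)‖ ≤ ψ t * (e / 2) := by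
        intro t
        by_cases ht : ψ t = 0
        · simp [ht]
        · have hts : t ∈ Function.support ψ := ht
          rw [hψ, φ.support_normed_eq, mem_ball_zero_iff] at hts
          have hy := hε (z - t) (hK t hts)
          rw [dist_comm, dist_zero_right, Real.norm_eq_abs] at hy
          rw [norm_mul, Real.norm_eq_abs, abs_of_nonneg (φ.nonneg_normed t), Real.norm_eq_abs]
          exact mul_le_mul_of_nonneg_left hy.le (φ.nonneg_normed t)
      have hI := norm_integral_le_of_norm_le ((φ.integrable_normed).mul_const (e / 2))
        (ae_of_all _ hbound)
      rw [integral_mul_const, φ.integral_normed, one_mul, Real.norm_eq_abs] at hI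
      linarith
    have := tendsto_nhds_unique lim₁ lim₂
    linarith
  have e₁ : ℓ₁ 1 = ℓ₂ ω := by simpa using key 1 (by simp)
  have e₂ : ℓ₁ Complex.I = ℓ₂ (ω * Complex.I) := key Complex.I (by simp)
  exact differentiableAt_sub_mul_of_dipole hω hd₁ hd₂ e₁ e₂

/-! ### The stub -/

/-- **stub S1b — from the cell dipole identity to the contour relation (36) (pure analysis).**
If `Gⁱ, G^{i+1}` are continuous on an open set `U` and satisfy the uniform-on-compacts dipole
identity with a unit `ω`, then `∮_{∂T} (G^{i+1} − ω Gⁱ) dz = 0` for every solid triangle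
`T ⊆ U`. (Mollify: for smooth functions the identity reads `D G^{i+1}[ωη] = D Gⁱ[η]`, i.e.
`∂̄G^{i+1} = ω ∂̄Gⁱ` since `|ω| = 1`, and Green's formula gives (36); pass to the limit in the
mollification using local uniformity. Smirnov's Lemma 2.3/2.4 is the lattice version.)
[size: M, true] -/
theorem stub_contourFromCells :
    ∀ (U : Set ℂ) (G : Fin 3 → ℂ → ℝ) (ω : ℂ) (i : Fin 3), IsOpen U → ‖ω‖ = 1 →
      ContinuousOn (G i) U → ContinuousOn (G (i + 1)) U →
      (∀ K : Set ℂ, IsCompact K → K ⊆ U → ∀ η : ℂ, ‖η‖ = 1 →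
        TendstoUniformlyOn
          (fun (ε : ℝ) (z : ℂ) =>
            (G i (z + (ε : ℂ) * η) - G i z
              - (G (i + 1) (z + (ε : ℂ) * (ω * η)) - G (i + 1) z)) / ε)
          (fun _ => (0 : ℝ)) (𝓝[>] (0 : ℝ)) K) →
      ∀ p q r : ℂ, convexHull ℝ {p, q, r} ⊆ U →
        triangleIntegral (fun w => (G (i + 1) w : ℂ) - ω * G i w) p q r = 0 := by
  intro U G ω i hU hω hG₁ hG₂ hdip p q r hT
  -- Step 1: compact neighbourhoods of the solid triangle inside `U`
  set T : Set ℂ := convexHull ℝ {p, q, r}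
  have hTc : IsCompact T := Set.Finite.isCompact_convexHull (𝕜 := ℝ) (Set.toFinite _)
  obtain ⟨δ₀, hδ₀, hK₀U⟩ := hTc.exists_cthickening_subset_open hU hT
  set K₀ : Set ℂ := cthickening δ₀ T
  have hK₀c : IsCompact K₀ := hTc.cthickening
  set K₁ : Set ℂ := cthickening (δ₀ / 2) T
  have hK₁c : IsCompact K₁ := hTc.cthickening
  have hK₁K₀ : K₁ ⊆ K₀ := cthickening_mono (by linarith) T
  have hK₁U : K₁ ⊆ U := hK₁K₀.trans hK₀U
  have hTK₀ : T ⊆ K₀ := self_subset_cthickening T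
  have hstep : ∀ y ∈ K₁, ∀ v : ℂ, ‖v‖ ≤ δ₀ / 2 → y + v ∈ K₀ := by
    intro y hy v hv
    have h1 : y + v ∈ cthickening (δ₀ / 2) K₁ :=
      mem_cthickening_of_dist_le (y + v) y (δ₀ / 2) K₁ hy (by simpa [dist_eq_norm] using hv)
    have h2 := cthickening_cthickening_subset (half_pos hδ₀).le (half_pos hδ₀).le T h1
    rwa [add_halves] at h2
  set V : Set ℂ := thickening (δ₀ / 4) T
  have hVK₁ : ∀ z ∈ V, ∀ t : ℂ, ‖t‖ < δ₀ / 4 → z - t ∈ K₁ := by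
    intro z hz t ht
    obtain ⟨x, hx, hzx⟩ := mem_thickening_iff.1 hz
    refine mem_cthickening_of_dist_le (z - t) x (δ₀ / 2) T hx ?_
    calc dist (z - t) x ≤ dist (z - t) z + dist z x := dist_triangle _ _ _
      _ = ‖t‖ + dist z x := by simp [dist_eq_norm]
      _ ≤ δ₀ / 2 := by linarith
  -- Step 2: globalise `G i`, `G (i+1)` by zero outside `K₀`
  set g : Fin 3 → ℂ → ℝ := fun j => K₀.indicator (G j)
  have hgG : ∀ j, ∀ y ∈ K₀, g j y = G j y := fun j y hy => indicator_of_mem hy _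
  have hgi₁ : Integrable (g i) volume :=
    (ContinuousOn.integrableOn_compact hK₀c (hG₁.mono hK₀U)).integrable_indicator hK₀c.measurableSet
  have hgi₂ : Integrable (g (i + 1)) volume :=
    (ContinuousOn.integrableOn_compact hK₀c (hG₂.mono hK₀U)).integrable_indicator hK₀c.measurableSet
  have hdip' : ∀ η : ℂ, ‖η‖ = 1 → TendstoUniformlyOn
      (fun (ε : ℝ) (y : ℂ) =>
        (g i (y + (ε : ℂ) * η) - g i y - (g (i + 1) (y + (ε : ℂ) * (ω * η)) - g (i + 1) y)) / ε)
      (fun _ => (0 : ℝ)) (𝓝[>] (0 : ℝ)) K₁ := by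
    intro η hη
    refine (hdip K₁ hK₁c hK₁U η hη).congr ?_
    filter_upwards [Ioo_mem_nhdsGT (half_pos hδ₀)] with ε hε y hy
    have hεn : ‖(ε : ℂ)‖ ≤ δ₀ / 2 := by
      rw [Complex.norm_real, Real.norm_eq_abs, abs_of_pos hε.1]; exact hε.2.le
    have h0 : y ∈ K₀ := hK₁K₀ hy
    have h1 : y + (ε : ℂ) * η ∈ K₀ := hstep y hy _ (by rw [norm_mul, hη, mul_one]; exact hεn)
    have h2 : y + (ε : ℂ) * (ω * η) ∈ K₀ :=
      hstep y hy _ (by rw [norm_mul, norm_mul, hω, hη, mul_one, mul_one]; exact hεn)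
    simp only [hgG _ _ h0, hgG _ _ h1, hgG _ _ h2]
  -- the mollifications `M φ j = φ.normed ⋆ g j` by normed bumps `φ`
  set M : ContDiffBump (0 : ℂ) → Fin 3 → ℂ → ℝ := fun φ j =>
    φ.normed volume ⋆[lsmul ℝ ℝ, volume] g j
  -- Steps 3–4: the mollified combination is holomorphic on `V ⊇ T`; Cauchy–Goursat
  have hzero : ∀ φ : ContDiffBump (0 : ℂ), φ.rOut ≤ δ₀ / 4 →
      triangleIntegral (fun w => (M φ (i + 1) w : ℂ) - ω * M φ i w) p q r = 0 := by
    intro φ hφ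
    refine triangleIntegral_eq_zero_of_differentiableOn (U := V) isOpen_thickening (fun z hz => ?_)
      (self_subset_thickening (by positivity) T)
    exact (differentiableAt_normed_convolution_comb φ hω hgi₁.locallyIntegrable
      hgi₂.locallyIntegrable (fun t ht => hVK₁ z hz t (ht.trans_le hφ))
      hdip').differentiableWithinAt
  -- Step 5: uniform approximation on `T` and the limit `δ → 0`
  have happrox : ∀ e > 0, ∃ φ : ContDiffBump (0 : ℂ), φ.rOut ≤ δ₀ / 4 ∧ ∀ z ∈ T,
      dist (M φ i z) (G i z) ≤ e ∧ dist (M φ (i + 1) z) (G (i + 1) z) ≤ e := by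
    intro e he
    obtain ⟨θ₁, hθ₁, h₁⟩ := Metric.uniformContinuousOn_iff.1
      (hK₀c.uniformContinuousOn_of_continuous (hG₁.mono hK₀U)) e he
    obtain ⟨θ₂, hθ₂, h₂⟩ := Metric.uniformContinuousOn_iff.1
      (hK₀c.uniformContinuousOn_of_continuous (hG₂.mono hK₀U)) e he
    set δ : ℝ := min (δ₀ / 4) (min (θ₁ / 2) (θ₂ / 2))
    have hδpos : 0 < δ := by positivity
    have hδ₁ : δ ≤ δ₀ / 4 := min_le_left _ _
    have hδθ₁ : δ < θ₁ := (min_le_right _ _).trans_lt ((min_le_left _ _).trans_lt (by linarith))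
    have hδθ₂ : δ < θ₂ := (min_le_right _ _).trans_lt ((min_le_right _ _).trans_lt (by linarith))
    have hball : ∀ z ∈ T, ∀ x ∈ ball z δ, x ∈ K₀ := fun z hz x hx =>
      mem_cthickening_of_dist_le x z δ₀ T hz (by linarith [mem_ball.1 hx])
    refine ⟨⟨δ / 2, δ, half_pos hδpos, half_lt_self hδpos⟩, hδ₁, fun z hz => ⟨?_, ?_⟩⟩
    · rw [← hgG i z (hTK₀ hz)]
      refine ContDiffBump.dist_normed_convolution_le hgi₁.aestronglyMeasurable fun x hx => ?_
      rw [hgG i x (hball z hz x hx), hgG i z (hTK₀ hz)]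
      exact (h₁ x (hball z hz x hx) z (hTK₀ hz) ((mem_ball.1 hx).trans hδθ₁)).le
    · rw [← hgG (i + 1) z (hTK₀ hz)]
      refine ContDiffBump.dist_normed_convolution_le hgi₂.aestronglyMeasurable fun x hx => ?_
      rw [hgG (i + 1) x (hball z hz x hx), hgG (i + 1) z (hTK₀ hz)]
      exact (h₂ x (hball z hz x hx) z (hTK₀ hz) ((mem_ball.1 hx).trans hδθ₂)).le
  have hFc : ContinuousOn (fun w => (G (i + 1) w : ℂ) - ω * G i w) T :=
    ((Complex.continuous_ofReal.comp_continuousOn (hG₂.mono hT)).sub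
      ((Complex.continuous_ofReal.comp_continuousOn (hG₁.mono hT)).const_smul ω)).congr
      fun w _ => by simp
  rw [← norm_le_zero_iff]
  refine le_of_forall_pos_le_add fun e he => ?_
  set L : ℝ := ‖q - p‖ + ‖r - q‖ + ‖p - r‖
  obtain ⟨φ, hφ, hd⟩ := happrox (e / (2 * (L + 1))) (by positivity)
  have hfc : Continuous fun w => (M φ (i + 1) w : ℂ) - ω * M φ i w :=
    (Complex.continuous_ofReal.comp
      (contDiff_normed_convolution φ hgi₂.locallyIntegrable).continuous).sub
      (continuous_const.mul (Complex.continuous_ofReal.comp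
        (contDiff_normed_convolution φ hgi₁.locallyIntegrable).continuous))
  have hsub : triangleIntegral (fun w => (G (i + 1) w : ℂ) - ω * G i w) p q r =
      triangleIntegral (fun w => ((G (i + 1) w : ℂ) - ω * G i w) -
        ((M φ (i + 1) w : ℂ) - ω * M φ i w)) p q r := by
    rw [triangleIntegral_sub hFc hfc.continuousOn, hzero φ hφ, sub_zero]
  rw [hsub, zero_add]
  calc ‖triangleIntegral (fun w => ((G (i + 1) w : ℂ) - ω * G i w) -
          ((M φ (i + 1) w : ℂ) - ω * M φ i w)) p q r‖
      ≤ (e / (2 * (L + 1)) + e / (2 * (L + 1))) * L := by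
        refine norm_triangleIntegral_le fun z hz => ?_
        obtain ⟨hz₁, hz₂⟩ := hd z hz
        rw [Real.dist_eq] at hz₁ hz₂
        have e1 : ((G (i + 1) z : ℂ) - ω * G i z) - ((M φ (i + 1) z : ℂ) - ω * M φ i z) =
            ((G (i + 1) z - M φ (i + 1) z : ℝ) : ℂ) - ω * ((G i z - M φ i z : ℝ) : ℂ) := by
          push_cast; ring
        rw [e1]
        calc ‖((G (i + 1) z - M φ (i + 1) z : ℝ) : ℂ) - ω * ((G i z - M φ i z : ℝ) : ℂ)‖
            ≤ ‖((G (i + 1) z - M φ (i + 1) z : ℝ) : ℂ)‖ + ‖ω * ((G i z - M φ i z : ℝ) : ℂ)‖ :=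
              norm_sub_le _ _
          _ ≤ e / (2 * (L + 1)) + e / (2 * (L + 1)) := by
              rw [norm_mul, hω, one_mul, Complex.norm_real, Complex.norm_real, Real.norm_eq_abs,
                Real.norm_eq_abs, abs_sub_comm, abs_sub_comm (G i z)]
              exact add_le_add hz₂ hz₁
    _ = e * (L / (L + 1)) := by field_simp; ring
    _ ≤ e := by
        refine mul_le_of_le_one_right he.le ?_
        rw [div_le_one (by positivity)]; linarith

end Summit.CriticalPhenomena.CardyFormulaZ2.Theorems.CardyRotToConfR2SymmetryUpgrade.ContinuumSmirnovDipole

end
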